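import Summits.BirchSwinnertonDyer.BirchSwinnertonDyer.Theorems.ManinLocalTwoThreeManinPrimeToAdditiveFiveLeRedFiveTypeIIFlipTwin
import Summits.BirchSwinnertonDyer.Rank1Residual.ManinAdditive.TwistOrbitManinNearInvariance
import HarnessLib

/-!
# Route `ManinLocalTwoThree`, residual crux C5 `ManinPrimeToAdditiveFiveLe`
# (stmt-BirchSwinnertonDyer-22969), line `upper_anchor` (skeleton v8, registered stub `stub_red57unstarredOffIIAtFive`):
# **the Kodaira-II cell at `p = 7` (tame index `e = 6 = p − 1`, Raynaud-void) rides its COMMUTING starred twin IV*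
# (`e = 3 < p − 1`) modulo a degree law — the `p = 7` twin of gen 3's RED(13♯) reduction**

Lead seat bsd-line-ml23-c5-p1 (gen 4). Cell census of the `W[p]`-reducible unstarred residue at `p ∈ {5, 7}` after v8
(`Cruxes/…/LEDGER-upper-anchor.md`, gen 4): the potentially SUPERSINGULAR cells (5; IV), (7; III) flip (Edixhoven's
Prop. 9 mechanism available, `e < p − 1`), the cell (5; II) rides its flip twin (p622240), and the potentially ORDINARY
cells (5; III), (7; II), (7; IV) COMMUTE with their starred twins (census N ≤ 5·10⁵: 377 + 112 + 43 orbits, all with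
`v_p(deg′) = v_p(deg) + 1`). Among the latter, (7; II) has `e = 6 = p − 1` (even Edixhoven's METHOD is void) while its
commuting twin (7; IV*) has `e = 3 < 6` — inside Raynaud's range, where Edixhoven's Prop. 7 («case 2 is forced for the
starred curve») is the printed mechanism at `p ≥ 11`.

THIS FILE proves, kernel-checked (same skeleton of proof as gen 3's `coreRED13sharp_of_edixhovenKodairaFact_of_degreeUp13Red`,
p618203, with the printed anchor EdK replaced by an OPEN anchor hypothesis at `p = 7`):

* `coreRED57unstarredOffII5_of_offII57_of_anchorIVstarSeven_of_degreeUpIISeven` —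
  **`stub_red57unstarredOffIIAtFive` (v7/v8, VERBATIM) ⟸ RED(57♯)[unstarred, off BOTH type-II cells (5; II), (7; II)]
  ∧ ANCHOR(7; IV*) ∧ DEGREE-UP(7; II)**, where
  - ANCHOR(7; IV*) := RED(57♯) (all the cuts: `W[7]` reducible, `49 ∣ N > 5·10⁵`, globally twist-minimal, `7 ∣ deg φ`,
    no `Iₙ*` fibre) for `W` of Kodaira type IV* at `7` (`ord₇ Δ_min = 8`, `e = 3`) ⟹ `7 ∤ c(D)` — Edixhoven's starred
    statement at `(p, e) = (7, 3)`, OPEN (not in print at `p = 7`; the mechanism of [EdixhovenManin1991, Prop. 7] needs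
    only `e < p − 1`); census: 112 optimal IV* `W[7]`-reducible curves in range, all `c = 1` (Cremona);
  - DEGREE-UP(7; II) := for `W` of type II at `7` with the cuts and every lattice-optimal `W′ ∼ W ⊗ (−7)` with
    `N(W′) = N(W)`: `deg(D′) = 7 · deg(D)` (no degree-down = Edixhoven case 1, no flip) — Manin-free, the `(7; II)`
    instance of gen 3's `DegreeUp13Red`; census: 112 / 112 orbits commuting with `v₇(deg′) = v₇(deg) + 1`.

PROOF. For `W` of type II at `7`: the lattice-optimal `W₀ ∼ W ⊗ (−7)` exists (modularity), `49 ∣ N(W₀) = N(W)`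
(twist-minimality), DEGREE-UP gives `deg₀ = 7·deg`, so in the cell's PROVED optimal-orbit trichotomy only case (i)
(commuting, `u • (W ⊗ (−7)) = W₀`) survives, and the PROVED near-invariance leaves `v₇ c(D₀) = v₇ c(D)` with
`ord₇ Δ_min(W₀) = 2 + 6 = 8`; the cuts transfer to `W₀` (reducibility, twist-minimality §3 of `…ReducibleTwistTransport`,
`7 ∣ deg₀ = 7·deg`, no `Iₙ*` by `kodairaSymbolAt_upper_starred`), so ANCHOR(7; IV*) gives `7 ∤ c(D₀)`, whence `7 ∤ c(D)`.
All other cells are passed to the first hypothesis.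

AFTER THIS FILE the cells of the `W[p]`-reducible residue of C5 at `p ∈ {5, 7}` WITHOUT a printed mechanism AND without
a twin rescue are exactly (5; III) [Kosters–Pannekoek corner, `e = 4 = p − 1` on both sides of the twin pair] and
(7; IV) [potentially ordinary unstarred, Edixhoven's case 1; its twin (7; II*) has `e = 6 = p − 1`]. Not registered as a
skeleton reshape (v8 stays the skeleton of record; optional v9 in the LEDGER). HONEST STATUS: conditional result
(`--supports`, helper) between OPEN statements. Nothing here proves the stub, C5, Manin's conjecture or BSD.

References: [EdixhovenManin1991] Thm. 3, Props. 7, 9, §4; [ZagierCMB1985] §1; [Stevens1989] (5.2), (5.4);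
[SilvermanATAEC1994] IV Table 4.1.
-/

set_option autoImplicit false
-- the Theorems namespace of this sub repeats the summit name by design (D-0017 nested layout)
set_option linter.dupNamespace false

noncomputable section

open scoped Classical NumberField

namespace Summit.BirchSwinnertonDyer.BirchSwinnertonDyer.Theorems

open WeierstrassCurve IsDedekindDomain IsDedekindDomain.HeightOneSpectrum Rat.HeightOneSpectrum NumberField
  Literature.NumberTheory.EllipticCurves Literature.NumberTheory.EllipticCurves.ModularForms
  Literature.NumberTheory.EllipticCurves.Rank1Residual
  Literature.NumberTheory.DiophantineGeometry
  Summit.BirchSwinnertonDyer.Rank1Residual.ManinAdditive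
  Summit.BirchSwinnertonDyer.Rank1Residual.Additive

/-- **`stub_red57unstarredOffIIAtFive` (v7/v8, VERBATIM as the conclusion) ⟸ RED(57♯)[unstarred, off (5; II) and
(7; II)] (`hA`) ∧ ANCHOR(7; IV*) (`hS`) ∧ DEGREE-UP(7; II) (`hUp`).** `hA` is the stub with the extra hypothesis
`p = 7 → ord_p Δ_min(W) ≠ 2`; `hS` is RED(57♯) (v4 binders of `stub_red57sharp`) for `W` with `ord_p Δ_min(W) = 8`
at `p = 7` (Kodaira IV*); `hUp` is the `(7; II)` instance of gen 3's degree law. See the module docstring for the proof.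
Conditional result between OPEN statements; nothing here proves C5. [cite: EdixhovenManin1991, Thm. 3 and §4]
[cite: ZagierCMB1985, §1] [cite: SilvermanATAEC1994, IV Table 4.1] -/
theorem coreRED57unstarredOffII5_of_offII57_of_anchorIVstarSeven_of_degreeUpIISeven
    (hA : mazur_not_dvd_maninConstant_of_odd → abbesUllmo_not_dvd_maninConstant_of_not_dvd_level →
      cesnavicius_not_two_dvd_maninConstant_of_two_dvd_level → exists_isNewformOf →
      ∀ (W : WeierstrassCurve ℚ) [W.IsElliptic] [W.IsGloballyMinimal] [NeZero (W.conductorNorm ℤ)]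
        (D : ModularParametrizationData W (W.conductorNorm ℤ)),
        IsLatticeOptimal D → ∀ (p : ℕ) (hp : p.Prime), (p = 5 ∨ p = 7) → p ^ 2 ∣ W.conductorNorm ℤ →
        ¬ (∃ (W' : WeierstrassCurve ℚ) (q : ℕ), W'.IsElliptic ∧ W'.IsGloballyMinimal ∧ q.Prime ∧
            q ≠ 2 ∧ q ^ 2 ∣ W.conductorNorm ℤ ∧
            IsIsogenous W (W'.quadraticTwist (((-1 : ℤ) ^ (q / 2) * q : ℤ) : ℚ)) ∧
            ¬ q ^ 2 ∣ W'.conductorNorm ℤ) →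
        ¬ (∃ (W' : WeierstrassCurve ℚ) (d : ℤ), W'.IsElliptic ∧ W'.IsGloballyMinimal ∧
            (d = -1 ∨ d = 2 ∨ d = -2) ∧ 2 ^ 2 ∣ W.conductorNorm ℤ ∧
            IsIsogenous W (W'.quadraticTwist (d : ℚ)) ∧ ¬ 2 ^ 2 ∣ W'.conductorNorm ℤ) →
        ¬ W.HasIrreducibleModPGaloisRep p →
        500000 < W.conductorNorm ℤ →
        p ∣ D.modularDegree →
        (∀ n : ℕ, W.kodairaSymbolAt ((Rat.HeightOneSpectrum.primesEquiv (R := ℤ)).symm ⟨p, hp⟩) ≠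
          .Istar n) →
        padicValInt p W.minimalDiscriminantInt ≤ 4 →
        (p = 5 → padicValInt p W.minimalDiscriminantInt ≠ 2) →
        (p = 7 → padicValInt p W.minimalDiscriminantInt ≠ 2) →
        ¬ (p : ℤ) ∣ D.maninConstant)
    (hS : mazur_not_dvd_maninConstant_of_odd → abbesUllmo_not_dvd_maninConstant_of_not_dvd_level →
      cesnavicius_not_two_dvd_maninConstant_of_two_dvd_level → exists_isNewformOf →
      ∀ (W : WeierstrassCurve ℚ) [W.IsElliptic] [W.IsGloballyMinimal] [NeZero (W.conductorNorm ℤ)]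
        (D : ModularParametrizationData W (W.conductorNorm ℤ)),
        IsLatticeOptimal D → ∀ (p : ℕ) (hp : p.Prime), (p = 5 ∨ p = 7) → p ^ 2 ∣ W.conductorNorm ℤ →
        ¬ (∃ (W' : WeierstrassCurve ℚ) (q : ℕ), W'.IsElliptic ∧ W'.IsGloballyMinimal ∧ q.Prime ∧
            q ≠ 2 ∧ q ^ 2 ∣ W.conductorNorm ℤ ∧
            IsIsogenous W (W'.quadraticTwist (((-1 : ℤ) ^ (q / 2) * q : ℤ) : ℚ)) ∧
            ¬ q ^ 2 ∣ W'.conductorNorm ℤ) →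
        ¬ (∃ (W' : WeierstrassCurve ℚ) (d : ℤ), W'.IsElliptic ∧ W'.IsGloballyMinimal ∧
            (d = -1 ∨ d = 2 ∨ d = -2) ∧ 2 ^ 2 ∣ W.conductorNorm ℤ ∧
            IsIsogenous W (W'.quadraticTwist (d : ℚ)) ∧ ¬ 2 ^ 2 ∣ W'.conductorNorm ℤ) →
        ¬ W.HasIrreducibleModPGaloisRep p →
        500000 < W.conductorNorm ℤ →
        p ∣ D.modularDegree →
        (∀ n : ℕ, W.kodairaSymbolAt ((Rat.HeightOneSpectrum.primesEquiv (R := ℤ)).symm ⟨p, hp⟩) ≠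
          .Istar n) →
        p = 7 → padicValInt p W.minimalDiscriminantInt = 8 →
        ¬ (p : ℤ) ∣ D.maninConstant)
    (hUp : exists_isNewformOf →
      ∀ (W : WeierstrassCurve ℚ) [W.IsElliptic] [W.IsGloballyMinimal] [NeZero (W.conductorNorm ℤ)]
        (D : ModularParametrizationData W (W.conductorNorm ℤ)),
        IsLatticeOptimal D → ∀ (p : ℕ) (hp : p.Prime), p = 7 → p ^ 2 ∣ W.conductorNorm ℤ →
        ¬ (∃ (W' : WeierstrassCurve ℚ) (q : ℕ), W'.IsElliptic ∧ W'.IsGloballyMinimal ∧ q.Prime ∧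
            q ≠ 2 ∧ q ^ 2 ∣ W.conductorNorm ℤ ∧
            IsIsogenous W (W'.quadraticTwist (((-1 : ℤ) ^ (q / 2) * q : ℤ) : ℚ)) ∧
            ¬ q ^ 2 ∣ W'.conductorNorm ℤ) →
        ¬ (∃ (W' : WeierstrassCurve ℚ) (d : ℤ), W'.IsElliptic ∧ W'.IsGloballyMinimal ∧
            (d = -1 ∨ d = 2 ∨ d = -2) ∧ 2 ^ 2 ∣ W.conductorNorm ℤ ∧
            IsIsogenous W (W'.quadraticTwist (d : ℚ)) ∧ ¬ 2 ^ 2 ∣ W'.conductorNorm ℤ) →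
        ¬ W.HasIrreducibleModPGaloisRep p →
        500000 < W.conductorNorm ℤ →
        p ∣ D.modularDegree →
        (∀ n : ℕ, W.kodairaSymbolAt ((Rat.HeightOneSpectrum.primesEquiv (R := ℤ)).symm ⟨p, hp⟩) ≠
          .Istar n) →
        padicValInt p W.minimalDiscriminantInt = 2 →
        ∀ (W' : WeierstrassCurve ℚ) [W'.IsElliptic] [W'.IsGloballyMinimal] [NeZero (W'.conductorNorm ℤ)]
          (D' : ModularParametrizationData W' (W'.conductorNorm ℤ)),
          IsLatticeOptimal D' → W'.conductorNorm ℤ = W.conductorNorm ℤ →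
          IsIsogenous (W.quadraticTwist (((-1 : ℤ) ^ (p / 2) * p : ℤ) : ℚ)) W' →
          D'.modularDegree = p * D.modularDegree) :
    mazur_not_dvd_maninConstant_of_odd → abbesUllmo_not_dvd_maninConstant_of_not_dvd_level →
    cesnavicius_not_two_dvd_maninConstant_of_two_dvd_level → exists_isNewformOf →
    ∀ (W : WeierstrassCurve ℚ) [W.IsElliptic] [W.IsGloballyMinimal] [NeZero (W.conductorNorm ℤ)]
      (D : ModularParametrizationData W (W.conductorNorm ℤ)),
      IsLatticeOptimal D → ∀ (p : ℕ) (hp : p.Prime), (p = 5 ∨ p = 7) → p ^ 2 ∣ W.conductorNorm ℤ →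
      ¬ (∃ (W' : WeierstrassCurve ℚ) (q : ℕ), W'.IsElliptic ∧ W'.IsGloballyMinimal ∧ q.Prime ∧
          q ≠ 2 ∧ q ^ 2 ∣ W.conductorNorm ℤ ∧
          IsIsogenous W (W'.quadraticTwist (((-1 : ℤ) ^ (q / 2) * q : ℤ) : ℚ)) ∧
          ¬ q ^ 2 ∣ W'.conductorNorm ℤ) →
      ¬ (∃ (W' : WeierstrassCurve ℚ) (d : ℤ), W'.IsElliptic ∧ W'.IsGloballyMinimal ∧
          (d = -1 ∨ d = 2 ∨ d = -2) ∧ 2 ^ 2 ∣ W.conductorNorm ℤ ∧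
          IsIsogenous W (W'.quadraticTwist (d : ℚ)) ∧ ¬ 2 ^ 2 ∣ W'.conductorNorm ℤ) →
      ¬ W.HasIrreducibleModPGaloisRep p →
      500000 < W.conductorNorm ℤ →
      p ∣ D.modularDegree →
      (∀ n : ℕ, W.kodairaSymbolAt ((Rat.HeightOneSpectrum.primesEquiv (R := ℤ)).symm ⟨p, hp⟩) ≠
        .Istar n) →
      padicValInt p W.minimalDiscriminantInt ≤ 4 →
      (p = 5 → padicValInt p W.minimalDiscriminantInt ≠ 2) →
      ¬ (p : ℤ) ∣ D.maninConstant := by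
  intro hM hAU hC hnf W _ _ _ D hD p hp h57 hpN hodd hdy hred hN hdeg hI hv h5II
  by_cases h2 : p = 7 ∧ padicValInt p W.minimalDiscriminantInt = 2
  swap
  · exact hA hM hAU hC hnf W D hD p hp h57 hpN hodd hdy hred hN hdeg hI hv h5II (fun h7 h2' ↦ h2 ⟨h7, h2'⟩)
  obtain ⟨hp7, hv2⟩ := h2
  haveI hpF : Fact p.Prime := ⟨hp⟩
  have h5 : 5 ≤ p := by omega
  have hp2 : p ≠ 2 := by omega
  have hd0 : ((((-1 : ℤ) ^ (p / 2) * p : ℤ)) : ℚ) ≠ 0 := by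
    push_cast
    exact mul_ne_zero (pow_ne_zero _ (by norm_num)) (by exact_mod_cast hp.ne_zero)
  haveI : (W.quadraticTwist ((((-1 : ℤ) ^ (p / 2) * p : ℤ)) : ℚ)).IsElliptic := W.isElliptic_quadraticTwist hd0
  -- the lattice-optimal globally minimal curve `W₀` of the class of `W ⊗ p*`
  obtain ⟨W₀, hE₀, hM₀, hne₀, D₀, hD₀, hiso⟩ :=
    exists_isIsogenous_latticeOptimal hnf (W.quadraticTwist ((((-1 : ℤ) ^ (p / 2) * p : ℤ)) : ℚ))
  haveI := hE₀
  haveI := hM₀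
  haveI := hne₀
  haveI : (W₀.quadraticTwist ((((-1 : ℤ) ^ (p / 2) * p : ℤ)) : ℚ)).IsElliptic := W₀.isElliptic_quadraticTwist hd0
  haveI : ((W.quadraticTwist ((((-1 : ℤ) ^ (p / 2) * p : ℤ)) : ℚ)).quadraticTwist
      ((((-1 : ℤ) ^ (p / 2) * p : ℤ)) : ℚ)).IsElliptic :=
    (W.quadraticTwist ((((-1 : ℤ) ^ (p / 2) * p : ℤ)) : ℚ)).isElliptic_quadraticTwist hd0
  -- `W ∼ W₀ ⊗ p*`
  have htw : IsIsogenous W (W₀.quadraticTwist ((((-1 : ℤ) ^ (p / 2) * p : ℤ)) : ℚ)) := by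
    obtain ⟨Cq, hCq⟩ := W.exists_variableChange_smul_eq_quadraticTwist_sq hd0
    have h1 : IsIsogenous W ((W.quadraticTwist ((((-1 : ℤ) ^ (p / 2) * p : ℤ)) : ℚ)).quadraticTwist
        ((((-1 : ℤ) ^ (p / 2) * p : ℤ)) : ℚ)) := by
      rw [quadraticTwist_quadraticTwist, ← sq, ← hCq]
      exact isIsogenous_smul _ _
    exact h1.trans' (hiso.quadraticTwist hd0)
  -- twist-minimality of `W` at `p`: `p² ∣ N(W₀)`; hence `N(W₀) = N(W)`
  have hpN₀ : p ^ 2 ∣ W₀.conductorNorm ℤ := by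
    by_contra h
    exact hodd ⟨W₀, p, hE₀, hM₀, hp, hp2, hpN, htw, h⟩
  have hNN : W₀.conductorNorm ℤ = W.conductorNorm ℤ :=
    conductorNorm_eq_of_isIsogenous_twist_pStar_of_sq_dvd hnf h5 htw hpN hpN₀
  have hadd : Addv W p := not_good_and_not_mult_of_sq_dvd_conductorNorm W hpN
  have hadd₀ : Addv W₀ p := not_good_and_not_mult_of_sq_dvd_conductorNorm W₀ hpN₀
  -- the degree law: `deg(D₀) = p · deg(D)`
  have hup : D₀.modularDegree = p * D.modularDegree :=
    hUp hnf W D hD p hp hp7 hpN hodd hdy hred hN hdeg hI hv2 W₀ D₀ hD₀ hNN hiso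
  have hpos : 0 < D.modularDegree := D.deg_pos
  have hc0 : D.c ≠ 0 := Int.cast_ne_zero.mp D.cast_c_ne_zero
  -- the optimal-orbit trichotomy: only case (i) is compatible with the degree law
  rcases pStar_optimal_orbit_trichotomy_full hp hp2 W W₀ D D₀ hD hD₀ hpN hNN hiso with
    ⟨⟨u, hu⟩, -, -⟩ | ⟨-, hdeg₂, -⟩ | hdeg₃
  · -- case (i): commuting; near-invariance along the commuting pair
    rcases pStar_optimal_commuting_manin_near_invariance hp hp2 W W₀ u D D₀ hD hD₀ hpN hNN hu
      with ⟨-, ⟨hc, hΔ⟩ | ⟨-, hΔ⟩⟩ | ⟨hdeg₂, -⟩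
    · -- `v_p c₀ = v_p c` and `W₀` is the UPPER member (type IV*, `ord_p Δ_min = 8`): ANCHOR applies to `(W₀, D₀)`
      have hst := kodairaSymbolAt_upper_starred h5 u hu hadd hadd₀ hΔ
      have hI₀ : ∀ n : ℕ,
          W₀.kodairaSymbolAt ((Rat.HeightOneSpectrum.primesEquiv (R := ℤ)).symm ⟨p, hp⟩) ≠ .Istar n := by
        intro n hn
        have hn' : W₀.kodairaSymbolAt (placeOf p) = .Istar n := hn
        rcases hst with ⟨h, -⟩ | ⟨h, -⟩ | ⟨h, -⟩ <;> rw [hn'] at h <;> exact KodairaSymbol.noConfusion h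
      have hred₀ : ¬ W₀.HasIrreducibleModPGaloisRep p := fun h ↦
        not_hasIrreducibleModPGaloisRep_of_isIsogenous htw hred
          ((hasIrreducibleModPGaloisRep_quadraticTwist_iff W₀ hd0 p).mpr h)
      have hdeg₀ : p ∣ D₀.modularDegree := ⟨D.modularDegree, hup⟩
      have hv₀8 : padicValInt p W₀.minimalDiscriminantInt = 8 := by omega
      have hnd : ¬ (p : ℤ) ∣ D₀.maninConstant :=
        hS hM hAU hC hnf W₀ D₀ hD₀ p hp h57 hpN₀
          (oddTwistMinimal_of_isIsogenous_twist_pStar hnf hp2 htw hpN hNN hodd)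
          (dyadicTwistMinimal_of_isIsogenous_twist_pStar hp2 htw hNN hdy)
          hred₀ (by rw [hNN]; exact hN) hdeg₀ hI₀ hp7 hv₀8
      have hv₀ : padicValInt p D₀.c = 0 := padicValInt.eq_zero_of_not_dvd hnd
      intro hpc
      have hpc' : (p : ℤ) ^ 1 ∣ D.c := by rw [pow_one]; exact hpc
      rcases (padicValInt_dvd_iff 1 D.c).mp hpc' with h | h
      · exact hc0 h
      · omega
    · -- the other branch would need `ord_p Δ_min(W₀) + 6 = ord_p Δ_min(W) = 2`
      omega
    · -- `p · deg₀ = deg` contradicts `deg₀ = p · deg > 0`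
      have : p * (p * D.modularDegree) = D.modularDegree := by rw [← hup]; exact hdeg₂
      nlinarith [hp.two_le]
  · -- case (ii): `p · deg₀ = deg` contradicts the degree law
    have : p * (p * D.modularDegree) = D.modularDegree := by rw [← hup]; exact hdeg₂
    nlinarith [hp.two_le]
  · -- case (iii): `deg₀ = deg` contradicts the degree law
    have : p * D.modularDegree = D.modularDegree := by rw [← hup]; exact hdeg₃
    nlinarith [hp.two_le]

end Summit.BirchSwinnertonDyer.BirchSwinnertonDyer.Theorems

end
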